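import Mathlib
import Summits.ValiantsHypothesis.ValiantsHypothesis.Theorems.DivisionGapPerMultiplesHardStubSpreadCaptureRel
import Summits.ValiantsHypothesis.ValiantsHypothesis.Theorems.DivisionGapPerMultiplesHardStubBregmanFibre
import Summits.ValiantsHypothesis.ValiantsHypothesis.Theorems.DivisionGapPerMultiplesHardDensePerHardReg
import Literature.Combinatorics.Enumerative.VanDerWaerdenPermanentProofs
import Literature.Combinatorics.Enumerative.VanDerWaerdenPermanent
import Literature.Combinatorics.Enumerative.BregmanMinc

/-!
# `DivisionGap.PerMultiplesHard` (stmt-ValiantsHypothesis-5068), line `uncharged-face-walk`: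
stub `stub_relRegularCount` — the fibre count on a REGULAR comparison host, no mixing

Let `Y' ⊆ [n]²` be an `f`-regular bipartite host (`f ≥ 1`; cells `(row, column)`; a permutation
`π` is INSIDE `Y'` when `(π j, j) ∈ Y'` for every column `j`), `P := PM(Y')` the set of
permutations inside `Y'`, `ζ` a row shift and `(S, T)` a typed rectangle capturing `P` up to the
factor `L`: `#P ≤ L · #Pc`, `Pc` the part of `P` compatible with `(S, T)`.  Then

  `#S ≤ 2 #T`, `#T ≤ 2 #S`, and
  `f^n · n! ≤ L · n^n · C(2 #S, #T) · (#T)! · ((f !)^{1/f})^{n - #T}`.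

This is the counting half of `RelDenseHost.stub_relDenseHost` with the TRIVIAL degree bounds in
place of the analytic estimate `RelDenseHostAux.fib_le` (no mixing hypothesis is used).

Proof chain (all ingredients are tree theorems of the line).
* van der Waerden (`DensePerHardReg.pow_mul_factorial_le_of_vdW`, its hypothesis discharged by
  `Literature.Combinatorics.Enumerative.VanDerWaerdenPermanent_holds`) gives
  `f^n · n! ≤ n^n · #P`, so `P ≠ ∅`, `Pc ≠ ∅` (capture hypothesis), and
  `SpreadCaptureRel.card_bounds_of_compatible` gives `#S ≤ 2 #T`, `#T ≤ 2 #S`.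
* A maximising fibre `{π ∈ P : π(T) = U}` over the valid images `U` (`Finset.exists_max_image`)
  and `SpreadCaptureRel.card_compatible_le` give `#Pc ≤ C(2 #S, #T) · #Fib(U)`.
* Brégman–Minc (`BregmanFibre.stub_bregmanFibre`): `#Fib(U) ≤ ∏_j (D_j !)^{1/D_j}` with the
  column degrees `D_j` of `Y'` into `U` (`j ∈ T`) resp. `Uᶜ` (`j ∉ T`); trivially `D_j ≤ #U = #T`
  for `j ∈ T` and `D_j ≤ f` (the column degree of `Y'`) for `j ∉ T`, so by monotonicity of
  `r ↦ (r !)^{1/r}` (`BregmanFibre.factorial_rpow_mono`) the product is at most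
  `((#T)!^{1/#T})^{#T} · ((f !)^{1/f})^{n - #T} = (#T)! · ((f !)^{1/f})^{n - #T}`
  (`prod_factorial_rpow_le`, `factorial_rpow_pow_self`).
* Assemble over `ℝ`.
-/

noncomputable section

-- `Summit.ValiantsHypothesis.ValiantsHypothesis.…` is the tree's mandated layout (Sub = Summit).
set_option linter.dupNamespace false

namespace Summit.ValiantsHypothesis.ValiantsHypothesis.Theorems.DivisionGap.PerMultiplesHard.RelRegularCount

open scoped NNReal BigOperators

/-! ### Two elementary estimates on the Brégman factors `(r !)^{1/r}` -/

/-- `((u !)^{1/u})^u = u !` for every `u : ℕ` (at `u = 0` both sides are `1`). [folklore] -/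
theorem factorial_rpow_pow_self (u : ℕ) :
    (((u.factorial : ℕ) : ℝ) ^ ((1 : ℝ) / (u : ℝ))) ^ u = (u.factorial : ℝ) := by
  rcases Nat.eq_zero_or_pos u with rfl | hu
  · simp
  · rw [one_div, Real.rpow_inv_natCast_pow (Nat.cast_nonneg _) hu.ne']

/-- **Trivial degree bounds in the Brégman product.**  If `D_j ≤ u` for `j ∈ T` and `D_j ≤ f`
for `j ∉ T`, then `∏_j (D_j !)^{1/D_j} ≤ ((u !)^{1/u})^{#T} · ((f !)^{1/f})^{n - #T}`
(monotonicity of `r ↦ (r !)^{1/r}`, `BregmanFibre.factorial_rpow_mono`, and the splitting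
`∏_j = ∏_{j ∈ T} · ∏_{j ∉ T}`). [folklore] -/
theorem prod_factorial_rpow_le {n : ℕ} (T : Finset (Fin n)) (D : Fin n → ℕ) (u f : ℕ)
    (hT : ∀ j ∈ T, D j ≤ u) (hC : ∀ j, j ∉ T → D j ≤ f) :
    ∏ j, (((D j).factorial : ℕ) : ℝ) ^ ((1 : ℝ) / (D j : ℝ)) ≤
      (((u.factorial : ℕ) : ℝ) ^ ((1 : ℝ) / (u : ℝ))) ^ T.card *
        (((f.factorial : ℕ) : ℝ) ^ ((1 : ℝ) / (f : ℝ))) ^ (n - T.card) := by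
  rw [← Finset.prod_mul_prod_compl T]
  have hTc : Tᶜ.card = n - T.card := by rw [Finset.card_compl, Fintype.card_fin]
  refine mul_le_mul ?_ ?_
    (Finset.prod_nonneg fun j _ => Real.rpow_nonneg (Nat.cast_nonneg _) _)
    (pow_nonneg (Real.rpow_nonneg (Nat.cast_nonneg _) _) _)
  · calc ∏ j ∈ T, (((D j).factorial : ℕ) : ℝ) ^ ((1 : ℝ) / (D j : ℝ))
        ≤ ∏ _j ∈ T, ((u.factorial : ℕ) : ℝ) ^ ((1 : ℝ) / (u : ℝ)) :=
          Finset.prod_le_prod (fun j _ => Real.rpow_nonneg (Nat.cast_nonneg _) _)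
            fun j hj => BregmanFibre.factorial_rpow_mono (hT j hj)
      _ = _ := Finset.prod_const _
  · rw [← hTc]
    calc ∏ j ∈ Tᶜ, (((D j).factorial : ℕ) : ℝ) ^ ((1 : ℝ) / (D j : ℝ))
        ≤ ∏ _j ∈ Tᶜ, ((f.factorial : ℕ) : ℝ) ^ ((1 : ℝ) / (f : ℝ)) :=
          Finset.prod_le_prod (fun j _ => Real.rpow_nonneg (Nat.cast_nonneg _) _)
            fun j hj => BregmanFibre.factorial_rpow_mono (hC j (Finset.mem_compl.mp hj))
      _ = _ := Finset.prod_const _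

/-! ### The stub -/

/-- **stub_relRegularCount — the fibre count on a REGULAR comparison host, no mixing.**  Let
`Y' ⊆ [n]²` be `f`-regular (`f ≥ 1`), `P := PM(Y')`, `ζ` a shift and `(S, T)` a typed rectangle
capturing `P`: `#P ≤ L · #(P ∩ compatible(S, T))`.  Then `#S ≤ 2 #T`, `#T ≤ 2 #S`, and
`f^n · n! ≤ L · n^n · C(2 #S, #T) · (#T)! · ((f !)^{1/f})^{n − #T}`.  Proof: van der Waerden
(`DensePerHardReg.pow_mul_factorial_le_of_vdW` with `VanDerWaerdenPermanent_holds`) gives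
`f^n · n! ≤ n^n · #P`, so `P` and its compatible part are nonempty and
`SpreadCaptureRel.card_bounds_of_compatible` gives the window relations;
`SpreadCaptureRel.card_compatible_le` with a maximising fibre `{π ∈ P : π(T) = U}` and
`BregmanFibre.stub_bregmanFibre` bound the compatible part by `C(2 #S, #T) · ∏_j (D_j !)^{1/D_j}`
with `D_j ≤ #U = #T` for `j ∈ T` and `D_j ≤ f` (column degree of `Y'`) for `j ∉ T`;
`BregmanFibre.factorial_rpow_mono` (`prod_factorial_rpow_le`) and `((u !)^{1/u})^u = u !`
(`factorial_rpow_pow_self`). [folklore] -/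
theorem stub_relRegularCount :
    ∀ (n : ℕ) (Y' : Finset (Fin n × Fin n)) (f : ℕ), 1 ≤ f →
      (∀ i : Fin n, (Finset.univ.filter fun j : Fin n => (i, j) ∈ Y').card = f) →
      (∀ j : Fin n, (Finset.univ.filter fun i : Fin n => (i, j) ∈ Y').card = f) →
      ∀ (ζ : Equiv.Perm (Fin n)) (S T : Finset (Fin n)) (L : ℕ),
        ((Finset.univ : Finset (Equiv.Perm (Fin n))).filter (fun π => ∀ j, (π j, j) ∈ Y')).card ≤
          L * (((Finset.univ : Finset (Equiv.Perm (Fin n))).filter (fun π => ∀ j, (π j, j) ∈ Y')).filter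
            fun π => (∀ i ∈ S, π.symm i ∈ T ∨ π.symm (ζ i) ∈ T) ∧
              (∀ j ∈ T, π j ∈ S ∨ ∃ i ∈ S, ζ i = π j)).card →
        S.card ≤ 2 * T.card ∧ T.card ≤ 2 * S.card ∧
        (f : ℝ) ^ n * (n.factorial : ℝ) ≤
          (L : ℝ) * (n : ℝ) ^ n * ((2 * S.card).choose T.card : ℝ) * (T.card.factorial : ℝ) *
            ((((f.factorial : ℕ) : ℝ) ^ ((1 : ℝ) / (f : ℝ))) ^ (n - T.card)) := by
  classical
  intro n Y' f hf hrow hcol ζ S T L hcap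
  -- (a) the comparison set `P = PM(Y')`
  set P : Finset (Equiv.Perm (Fin n)) :=
    (Finset.univ : Finset (Equiv.Perm (Fin n))).filter fun π : Equiv.Perm (Fin n) =>
      ∀ j, (π j, j) ∈ Y' with hP
  -- (b) van der Waerden: `f^n · n! ≤ n^n · #P`
  have h1 : f ^ n * n.factorial ≤ n ^ n * P.card :=
    DensePerHardReg.pow_mul_factorial_le_of_vdW
      Literature.Combinatorics.Enumerative.VanDerWaerdenPermanent_holds Y' hf hrow hcol
  have hf0 : 0 < f := hf
  have hLHSpos : 0 < f ^ n * n.factorial := by positivity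
  -- (c) a compatible permutation exists; the size constraints
  have hPcne : (P.filter fun π => (∀ i ∈ S, π.symm i ∈ T ∨ π.symm (ζ i) ∈ T) ∧
      (∀ j ∈ T, π j ∈ S ∨ ∃ i ∈ S, ζ i = π j)).Nonempty := by
    apply Finset.card_pos.mp
    apply Nat.pos_of_ne_zero
    intro h0
    have h2 : P.card ≤ 0 :=
      calc P.card ≤ _ := hcap
        _ = 0 := by rw [h0, mul_zero]
    have h3 : f ^ n * n.factorial ≤ 0 :=
      calc f ^ n * n.factorial ≤ n ^ n * P.card := h1
        _ = 0 := by rw [Nat.le_zero.mp h2, mul_zero]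
    exact absurd h3 (not_le.mpr hLHSpos)
  obtain ⟨π₀, hπ₀⟩ := hPcne
  obtain ⟨-, ha, hb⟩ := Finset.mem_filter.mp hπ₀
  obtain ⟨hk2u, hu2k⟩ := SpreadCaptureRel.card_bounds_of_compatible ζ S T π₀ ha hb
  obtain ⟨hUW₀, hUcard₀, -⟩ := SpreadCaptureRel.image_valid_of_compatible ζ S T π₀ ha hb
  refine ⟨hk2u, hu2k, ?_⟩
  -- (d) the maximising fibre
  obtain ⟨U, hUV, hUmax⟩ := Finset.exists_max_image ((S ∪ S.image ⇑ζ).powersetCard T.card)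
    (fun U => (P.filter fun π : Equiv.Perm (Fin n) => T.image ⇑π = U).card)
    ⟨T.image ⇑π₀, Finset.mem_powersetCard.mpr ⟨hUW₀, hUcard₀⟩⟩
  obtain ⟨-, hUu⟩ := Finset.mem_powersetCard.mp hUV
  have h3 : (P.filter fun π => (∀ i ∈ S, π.symm i ∈ T ∨ π.symm (ζ i) ∈ T) ∧
      (∀ j ∈ T, π j ∈ S ∨ ∃ i ∈ S, ζ i = π j)).card ≤
      (2 * S.card).choose T.card *
        (P.filter fun π : Equiv.Perm (Fin n) => T.image ⇑π = U).card :=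
    SpreadCaptureRel.card_compatible_le ζ S T P _ fun U' hU'W hU'c =>
      hUmax U' (Finset.mem_powersetCard.mpr ⟨hU'W, hU'c⟩)
  -- the fibre in Brégman's form
  have hFU : (P.filter fun π : Equiv.Perm (Fin n) => T.image ⇑π = U) =
      ((Finset.univ : Finset (Equiv.Perm (Fin n))).filter fun π : Equiv.Perm (Fin n) =>
        (∀ j, (π j, j) ∈ Y') ∧ T.image ⇑π = U) := by
    rw [hP, Finset.filter_filter]
  rw [hFU] at h3
  -- (e) the counting chain in `ℕ`
  have hchain : f ^ n * n.factorial ≤ n ^ n * (L * ((2 * S.card).choose T.card *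
      ((Finset.univ : Finset (Equiv.Perm (Fin n))).filter fun π : Equiv.Perm (Fin n) =>
        (∀ j, (π j, j) ∈ Y') ∧ T.image ⇑π = U).card)) :=
    h1.trans (Nat.mul_le_mul_left _ (hcap.trans (Nat.mul_le_mul_left _ h3)))
  -- (f) Brégman with the trivial degree bounds: `#Fib(U) ≤ (#T)! · ((f !)^{1/f})^{n - #T}`
  have hdegT : ∀ j ∈ T, (if j ∈ T then U.filter (fun i => (i, j) ∈ Y')
      else Uᶜ.filter (fun i => (i, j) ∈ Y')).card ≤ T.card := by
    intro j hj
    rw [if_pos hj]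
    exact (Finset.card_filter_le _ _).trans_eq hUu
  have hdegC : ∀ j, j ∉ T → (if j ∈ T then U.filter (fun i => (i, j) ∈ Y')
      else Uᶜ.filter (fun i => (i, j) ∈ Y')).card ≤ f := by
    intro j hj
    rw [if_neg hj]
    exact (Finset.card_le_card (Finset.filter_subset_filter _ (Finset.subset_univ _))).trans_eq
      (hcol j)
  have hfib : ((((Finset.univ : Finset (Equiv.Perm (Fin n))).filter fun π : Equiv.Perm (Fin n) =>
      (∀ j, (π j, j) ∈ Y') ∧ T.image ⇑π = U).card : ℕ) : ℝ) ≤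
      (T.card.factorial : ℝ) * ((((f.factorial : ℕ) : ℝ) ^ ((1 : ℝ) / (f : ℝ))) ^ (n - T.card)) := by
    have h := (BregmanFibre.stub_bregmanFibre n Y' T U).trans
      (prod_factorial_rpow_le T _ T.card f hdegT hdegC)
    rwa [factorial_rpow_pow_self] at h
  -- (g) assemble over `ℝ`
  have hchainR : (f : ℝ) ^ n * n.factorial ≤ (n : ℝ) ^ n * ((L : ℝ) *
      (((2 * S.card).choose T.card : ℝ) *
        ((((Finset.univ : Finset (Equiv.Perm (Fin n))).filter fun π : Equiv.Perm (Fin n) =>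
          (∀ j, (π j, j) ∈ Y') ∧ T.image ⇑π = U).card : ℕ) : ℝ))) := by
    exact_mod_cast hchain
  calc (f : ℝ) ^ n * n.factorial
      ≤ (n : ℝ) ^ n * ((L : ℝ) * (((2 * S.card).choose T.card : ℝ) *
        ((((Finset.univ : Finset (Equiv.Perm (Fin n))).filter fun π : Equiv.Perm (Fin n) =>
          (∀ j, (π j, j) ∈ Y') ∧ T.image ⇑π = U).card : ℕ) : ℝ))) := hchainR
    _ ≤ (n : ℝ) ^ n * ((L : ℝ) * (((2 * S.card).choose T.card : ℝ) *
        ((T.card.factorial : ℝ) *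
          ((((f.factorial : ℕ) : ℝ) ^ ((1 : ℝ) / (f : ℝ))) ^ (n - T.card))))) := by
        gcongr
    _ = _ := by ring

end Summit.ValiantsHypothesis.ValiantsHypothesis.Theorems.DivisionGap.PerMultiplesHard.RelRegularCount

end
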